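/-
Copyright: lit-balaban cell, Phase-2 proof seat p33 (gen 6).  Statement-level skeleton of a published paper; no proof claims beyond
what the kernel checks below.
-/
import Literature.MathematicalPhysics.QuantumFieldTheory.BalabanImbrieJaffe1984to88.BIJ85BlockAveragingIneq
import Literature.MathematicalPhysics.QuantumFieldTheory.Balaban1983to89.Beta.CoordCubePoincare

/-!
# `BalabanImbrieJaffe1984to88.BIJ85BlockKPoincare` — T. Bałaban, J. Imbrie, A. Jaffe, *Renormalization of the Higgs model:
minimizers, propagators and the stability of mean field theory*, Commun. Math. Phys. **97** (1985) 299–329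
[BalabanImbrieJaffe1985]: the `k`-BLOCK POINCARÉ INEQUALITY on the torus carriers of record and the COERCIVITY of
`a_kQ_k(u)^*Q_k(u) + D_u^*D_u` at a background `u` whose bond variables are close to `1` INSIDE the `k`-blocks — the elementary
`η`-lattice half of the unprinted *"extension of the proofs of [7]"* behind (7.3.2) p. 326 (companion of this seat's `BIJ85Ineq732PullBack`
p262642 and `BIJ85HolonomyDeviation` p263367; SKELETON row **C1.Eq7.3.1-7.3.2**, GAPS G-C1-05).

statement-level skeleton of published theorems with citation tags; proofs where landed; nothing here is a claim about the Yang–Mills mass gap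

PDF held: `paper:balaban1985-cmp97-bij-higgs-minimizers` (journal page = PDF page + 298).  Pages read (`lit read`, OCR text): p. 302–303
[PDF 4–5] ((2.4)–(2.6), (2.10)), p. 326 [PDF 28] ((7.3.1)–(7.3.2) and the remark *"by change of gauge u_k can be transformed in a local
region Λ into a configuration of the form exp[ie_kηA], where A is smooth and small"*).

CITATION HEADER (lean-in-tree rule).  Phase-2 file of the lit-balaban TYPED SKELETON (HOME `run/shared/lean/pub/lit-balaban/`), seat p33 gen 6
(unit `lit-balaban-p33-g6`; TAKING line HOME/STATUS.md 2026-08-21T10:38:53Z; owner r15, referee ref-5), in support of SKELETON row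
**C1.Eq7.3.1-7.3.2** (GAPS G-C1-05: the general background (4.5.4)).  Carriers of record only, BY NAME: `Balaban1983to89.Site/PBond/GaugeField`,
`blockOf` (B12 centred blocks = integer division by `L`), p11's `blkIter k x = x_k`, `blockK k y = B^k(y)`, `holCK U k x = u(Γ^{(k)}_{x_k,x})`,
`qCovK U k = Q_k(u)` (`BIJ85BlockAveragesTorusK`), the β-cell's coordinate-cube Poincaré inequality `Beta.CoordCubePoincare.blockPoincare_of_charts`
(constant `n(n+1)/2` on `Fin d → Fin (n+1)`).  ONE definition with a body (the chart `chartK`), no structure, no instance, no named fact.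

THE PRINTED TEXT, verbatim.  p. 302 [PDF 4]: *"Imbed the unit lattice in an L-lattice of block B(y). Here y = Ln denotes a corner of a block,
and n ∈ ℤ^d. Then B(y) consists of the L^d lattice sites x with coordinates y_j ≤ x_j < y_j + L, j = 1,2,…,d. (2.4)"*; p. 303 [PDF 5]:
*"(Qφ)(y) = L^{−d} Σ_{x∈B(y)} u(Γ_{yx})φ_x. (2.6)"*; p. 326 [PDF 28]: *"⟨φ, Δ_k(u_k)φ⟩ ≥ γ Σ_{b∈T₁^{(k)}} |u_k(b)φ(b₊) − φ(b₋)|² − Me_k^{2−α} Σ_{x∈T₁^{(k)}}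
|φ(x)|². (7.3.2) … These inequalities can be proved by an extension of the proofs of [7]. … by change of gauge u_k can be transformed in a
local region Λ into a configuration of the form exp[ie_kηA], where A is smooth and small."*

WHAT IS PROVED (0 `sorry`, standard axioms).
* §0 `k`-block arithmetic of the tori: `sitesPerDir j = sitesPerDir (j+k)·L^k`, `(x_k)_κ = x_κ / L^k` (`val_blkIter`).
* §1 THE `k`-BLOCK CHARTS `chartK k y : (Fin d → Fin L^k) → B^k(y)`, `r ↦` the site of label `y·L^k + r` (offsets from the lowest label):
  lands in `B^k(y)` (`blkIter_chartK`), injective (`chartK_injective`), jointly onto (`chartK_surj`), and a unit step inside the cube is a unit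
  step on the torus (`chartK_stepUp`) — the `k`-block version of p11's one-level charts in `BIJ85FluctuationCovarianceFlatBounds`.
* §2 **THE `k`-BLOCK POINCARÉ INEQUALITY** (`var_blockK_le`): for every real `f` on `T^{(j)}` and every `k`-block,
  `Σ_{x∈B^k(y)} (f(x) − avg_{B^k(y)} f)² ≤ ((L^k − 1)L^k/2)·Σ_{b⊂B^k(y)} (f(b₊) − f(b₋))²` (bonds with both ends in the block); the complex
  form with an ARBITRARY centre `c` (`sum_norm_sub_sq_le`): `Σ_{x∈B^k(y)} |φ(x) − c|² ≤ ((L^k−1)L^k/2)·Σ_{b⊂B^k(y)} |φ(b₊) − φ(b₋)|² +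
  L^{−kd}|Σ_{x∈B^k(y)} (φ(x) − c)|²` (Steiner).
* §3 **COERCIVITY AT A BACKGROUND CLOSE TO `1` INSIDE THE BLOCKS** (`sum_norm_sq_le_cov`): if `|u_b − 1| ≤ T` for every bond `b` with both
  ends in one `k`-block and `|u(Γ^{(k)}_{x_k,x}) − 1| ≤ δ` for every `x`, then for every `φ : T^{(j)} → ℂ`
  `(1 − 2(L^k−1)L^k·d·T² − 2δ²)·Σ_x |φ(x)|² ≤ 2(L^k−1)L^k·Σ_b |u_bφ(b₊) − φ(b₋)|² + 2L^{kd}·Σ_y |(Q_k(u)φ)(y)|²`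
  (with `n = L^k`, `N = L^{kd}`: if the two smallness terms sum to `≤ ½` this is `N^{−1}Σ|φ|² ≤ 4(n²/N)Σ_b|D_uφ|² + 4‖Q_k(u)φ‖²`, uniform in
  `k` and the volume).  At `u = 1` (`T = δ = 0`) it is the flat `k`-block Poincaré–Steiner bound.
HONEST SCOPE.  Elementary (Steiner + the cube Poincaré inequality + triangle inequalities); nothing of Sect. 7.3 is claimed here.  The
transport-UNIFORM comb/tree coercivity of `Balaban1983to89.B9Thm37GlueTorusCovPoinc.coercive_covLapCov_torus` (pv21, constant
`((a w²)^{−1} + d(M₀−1)M₀^d/c²)^{−1}` for blocks of FIXED side `M₀`) is a different statement and is not used: for growing blocks `L^k` the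
comb constant is not uniform in `k`, which is why smallness inside the blocks is traded for the `n²`-Poincaré constant here.
-/

open scoped BigOperators
open Finset

namespace Literature.MathematicalPhysics.QuantumFieldTheory.BalabanImbrieJaffe1984to88.BIJ85BlockKPoincare

open Literature.MathematicalPhysics.QuantumFieldTheory.Balaban1983to89
open BIJ88Sect3Statements (U1 toC norm_toC)
open BIJ85Sect1Model (HiggsField)
open BIJ85BlockAveragesTorus BIJ85BlockAveragesTorusK BIJ85BlockAveragingIneq
open Beta.BlockPoincare (avg sum_sq_sub_eq)
open Beta.CoordCubePoincare (stepUp blockPoincare_of_charts)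

noncomputable section

variable {P : Params} {j : ℕ}

/-! ## §0 `k`-block arithmetic of the tori -/

/-- kernel: `2L^{m+K−j} = 2L^{m+K−(j+k)}·L^k` — `L^k` sites of `T^{(j)}` per direction over each site of `T^{(j+k)}` (standing range
`j + k ≤ m + K`; the block (2.4) iterated `k` times). [cite: BalabanImbrieJaffe1985, (2.4) p.302] -/
theorem sitesPerDir_eq_mul_pow {k : ℕ} (hk : j + k ≤ P.m + P.K) : P.sitesPerDir j = P.sitesPerDir (j + k) * P.L ^ k := by
  unfold Params.sitesPerDir
  have h : P.m + P.K - j = (P.m + P.K - (j + k)) + k := by omega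
  rw [h, pow_add, mul_assoc]

/-- kernel: the label of the `k`-fold block point is `x_κ / L^k` (integer division; (2.4) iterated, standing range).
[cite: BalabanImbrieJaffe1985, (2.4) p.302] -/
theorem val_blkIter : ∀ (k : ℕ), j + k ≤ P.m + P.K → ∀ (x : Balaban1983to89.Site P j) (κ : Fin P.d),
    (blkIter k x κ).val = (x κ).val / P.L ^ k
  | 0, _, x, κ => by rw [blkIter_zero, pow_zero, Nat.div_one]
  | k + 1, hk, x, κ => by
    rw [blkIter_succ, Balaban1983to89.Site.val_blockOf (by omega) (blkIter k x) κ, val_blkIter k (by omega) x κ, pow_succ,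
      Nat.div_div_eq_div_mul]

/-- `(L^k − 1) + 1 = L^k`. [cite: BalabanImbrieJaffe1985, (2.4) p.302] -/
theorem predPow_succ (P : Params) (k : ℕ) : P.L ^ k - 1 + 1 = P.L ^ k := Nat.sub_add_cancel (pow_pos P.L_pos k)

/-! ## §1 The `k`-block charts -/

/-- **The `k`-block chart** `{0,…,L^k−1}^d → B^k(y)`: the site of `T^{(j)}` with label `y_κ·L^k + r_κ` in direction `κ` (offsets from the
lowest label of the block (2.4), iterated `k` times; typed on `Fin ((L^k−1)+1)` to meet `Beta.CoordCubePoincare`).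
[cite: BalabanImbrieJaffe1985, (2.4) p.302] -/
def chartK (k : ℕ) (y : Balaban1983to89.Site P (j + k)) (r : Fin P.d → Fin (P.L ^ k - 1 + 1)) : Balaban1983to89.Site P j :=
  fun κ => (((y κ).val * P.L ^ k + r κ : ℕ) : ZMod (P.sitesPerDir j))

/-- kernel: the label of `chartK k y r` is `y·L^k + r` (no wrap-around in the standing range). [cite: BalabanImbrieJaffe1985, (2.4) p.302] -/
theorem val_chartK {k : ℕ} (hk : j + k ≤ P.m + P.K) (y : Balaban1983to89.Site P (j + k)) (r : Fin P.d → Fin (P.L ^ k - 1 + 1))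
    (κ : Fin P.d) : ((chartK k y r) κ).val = (y κ).val * P.L ^ k + r κ := by
  simp only [chartK]
  rw [ZMod.val_natCast, Nat.mod_eq_of_lt]
  have hy : (y κ).val + 1 ≤ P.sitesPerDir (j + k) := ZMod.val_lt (y κ)
  have h1 : ((y κ).val + 1) * P.L ^ k ≤ P.sitesPerDir (j + k) * P.L ^ k := Nat.mul_le_mul_right _ hy
  have h2 : (r κ : ℕ) < P.L ^ k := by have h := (r κ).isLt; have hp := pow_pos P.L_pos k; omega
  rw [sitesPerDir_eq_mul_pow hk]
  rw [Nat.add_mul, one_mul] at h1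
  omega

/-- kernel: `chartK k y r ∈ B^k(y)`. [cite: BalabanImbrieJaffe1985, (2.4) p.302] -/
theorem blkIter_chartK {k : ℕ} (hk : j + k ≤ P.m + P.K) (y : Balaban1983to89.Site P (j + k)) (r : Fin P.d → Fin (P.L ^ k - 1 + 1)) :
    blkIter k (chartK k y r) = y := by
  funext κ
  apply ZMod.val_injective
  have h2 : (r κ : ℕ) < P.L ^ k := by have h := (r κ).isLt; have hp := pow_pos P.L_pos k; omega
  rw [val_blkIter k hk, val_chartK hk, mul_comm, Nat.mul_add_div (pow_pos P.L_pos k), Nat.div_eq_of_lt h2, add_zero]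

/-- kernel: the chart is injective. [cite: BalabanImbrieJaffe1985, (2.4) p.302] -/
theorem chartK_injective {k : ℕ} (hk : j + k ≤ P.m + P.K) (y : Balaban1983to89.Site P (j + k)) :
    Function.Injective (chartK k y) := by
  intro r r' h
  funext κ
  have hv := congrArg (fun x : Balaban1983to89.Site P j => (x κ).val) h
  simp only [val_chartK hk, add_right_inj] at hv
  exact Fin.ext hv

/-- kernel: the charts are jointly onto — every site is the chart point of its own `k`-block at the offsets `x_κ mod L^k`.
[cite: BalabanImbrieJaffe1985, (2.4) p.302] -/
theorem chartK_surj {k : ℕ} (hk : j + k ≤ P.m + P.K) (x : Balaban1983to89.Site P j) : ∃ r, chartK k (blkIter k x) r = x := by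
  refine ⟨fun κ => ⟨(x κ).val % P.L ^ k, by rw [predPow_succ]; exact Nat.mod_lt _ (pow_pos P.L_pos k)⟩, ?_⟩
  funext κ
  apply ZMod.val_injective
  rw [val_chartK hk, val_blkIter k hk]
  exact Nat.div_add_mod' ((x κ).val) (P.L ^ k)

/-- kernel: a unit step inside the cube is a unit step on the torus. [cite: BalabanImbrieJaffe1985, (2.4) p.302] -/
theorem chartK_stepUp {k : ℕ} (y : Balaban1983to89.Site P (j + k)) (r : Fin P.d → Fin (P.L ^ k - 1 + 1)) (μ : Fin P.d)
    (hr : r μ ≠ Fin.last (P.L ^ k - 1)) : (chartK k y r).shift μ = chartK k y (stepUp r μ) := by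
  funext κ
  simp only [Balaban1983to89.Site.shift, chartK, stepUp]
  by_cases hκ : κ = μ
  · subst hκ
    simp only [Function.update_self, Fin.val_add_one, if_neg hr]
    push_cast
    ring
  · simp only [Function.update_of_ne hκ, chartK]

/-! ## §2 The `k`-block Poincaré inequality -/

/-- **THE `k`-BLOCK POINCARÉ INEQUALITY ON THE TORUS** (real form): for every `f : T^{(j)} → ℝ` and every `k`-block `B^k(y)` (`j + k ≤ m + K`),
`Σ_{x∈B^k(y)} (f(x) − avg f)² ≤ ((L^k−1)L^k/2)·Σ_{b : b₋,b₊∈B^k(y)} (f(b₊) − f(b₋))²` — `Beta.CoordCubePoincare.blockPoincare_of_charts` with the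
charts of §1 and the internal bonds listed by (direction, offset).  Kernel mechanism of the `η`-lattice Poincaré step in *"the proofs of [7]"*.
[cite: BalabanImbrieJaffe1985, (7.3.2) p.326] -/
theorem var_blockK_le {k : ℕ} (hk : j + k ≤ P.m + P.K) (y : Balaban1983to89.Site P (j + k)) (f : Balaban1983to89.Site P j → ℝ) :
    ∑ x ∈ blockK k y, (f x - avg (blockK k y) f) ^ 2
      ≤ ((P.L : ℝ) ^ k - 1) * (P.L : ℝ) ^ k / 2 *
        ∑ b ∈ univ.filter (fun b : PBond P j => blkIter k b.src = y ∧ blkIter k b.tgt = y), (f b.tgt - f b.src) ^ 2 := by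
  classical
  have hC : ((P.L ^ k - 1 : ℕ) : ℝ) * ((P.L ^ k - 1 : ℕ) + 1) / 2 = ((P.L : ℝ) ^ k - 1) * (P.L : ℝ) ^ k / 2 := by
    rw [Nat.cast_pred (pow_pos P.L_pos k), Nat.cast_pow]; ring
  have h := blockPoincare_of_charts (blkIter k) PBond.src PBond.tgt (P.L ^ k - 1) P.d (chartK k)
    (fun y r => blkIter_chartK hk y r) (chartK_injective hk) (chartK_surj hk) (fun y μ r => (⟨chartK k y r, μ⟩ : PBond P j))
    (fun _ _ _ _ => rfl) (fun y μ r hr => chartK_stepUp y r μ hr)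
    (fun y p _ p' _ h => by
      simp only [PBond.mk.injEq] at h
      exact Prod.ext h.2 (chartK_injective hk y h.1)) y f
  rw [hC] at h
  exact h

/-- `‖z‖² = (Re z)² + (Im z)²`. [folklore] -/
private theorem norm_sq_re_im (z : ℂ) : ‖z‖ ^ 2 = z.re ^ 2 + z.im ^ 2 := by
  rw [Complex.sq_norm, Complex.normSq_apply]; ring

/-- `|s|·(avg_s f − t)² = (Σ_{x∈s} (f(x) − t))²/|s|` for a non-empty `s`. [folklore] -/
private theorem card_mul_avg_sub_sq {ι : Type*} (s : Finset ι) (hs : (s.card : ℝ) ≠ 0) (f : ι → ℝ) (t : ℝ) :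
    (s.card : ℝ) * (avg s f - t) ^ 2 = (∑ x ∈ s, (f x - t)) ^ 2 / s.card := by
  rw [sum_sub_distrib, sum_const, nsmul_eq_mul, avg]
  field_simp

/-- **THE `k`-BLOCK POINCARÉ INEQUALITY, complex form with an arbitrary centre** `c`: for every `φ : T^{(j)} → ℂ`, every `k`-block and every
`c ∈ ℂ`, `Σ_{x∈B^k(y)} |φ(x) − c|² ≤ ((L^k−1)L^k/2)·Σ_{b : b₋,b₊∈B^k(y)} |φ(b₊) − φ(b₋)|² + L^{−kd}·|Σ_{x∈B^k(y)} (φ(x) − c)|²` (Steiner's identity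
about `c` for the real and imaginary parts, then `var_blockK_le`; the last term is `L^{kd}·|mean − c|²`). [cite: BalabanImbrieJaffe1985, (7.3.2) p.326] -/
theorem sum_norm_sub_sq_le {k : ℕ} (hk : j + k ≤ P.m + P.K) (y : Balaban1983to89.Site P (j + k)) (φ : HiggsField P j) (c : ℂ) :
    ∑ x ∈ blockK k y, ‖φ x - c‖ ^ 2
      ≤ ((P.L : ℝ) ^ k - 1) * (P.L : ℝ) ^ k / 2
          * ∑ b ∈ univ.filter (fun b : PBond P j => blkIter k b.src = y ∧ blkIter k b.tgt = y), ‖φ b.tgt - φ b.src‖ ^ 2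
        + ((P.L : ℝ) ^ (k * P.d))⁻¹ * ‖∑ x ∈ blockK k y, (φ x - c)‖ ^ 2 := by
  set B := blockK k y with hB
  set S := univ.filter (fun b : PBond P j => blkIter k b.src = y ∧ blkIter k b.tgt = y) with hS
  set fR : Balaban1983to89.Site P j → ℝ := fun x => (φ x).re with hfR
  set fI : Balaban1983to89.Site P j → ℝ := fun x => (φ x).im with hfI
  have hN : (B.card : ℝ) = (P.L : ℝ) ^ (k * P.d) := by rw [hB, card_blockK k hk, Nat.cast_pow]
  have hNpos : (0 : ℝ) < (P.L : ℝ) ^ (k * P.d) := pow_pos (Nat.cast_pos.2 P.L_pos) _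
  have hR := sum_sq_sub_eq B fR c.re
  have hI := sum_sq_sub_eq B fI c.im
  have hPR := var_blockK_le hk y fR
  have hPI := var_blockK_le hk y fI
  have hL : ∑ x ∈ B, ‖φ x - c‖ ^ 2 = ∑ x ∈ B, (fR x - c.re) ^ 2 + ∑ x ∈ B, (fI x - c.im) ^ 2 := by
    rw [← sum_add_distrib]
    exact sum_congr rfl fun x _ => by rw [norm_sq_re_im, Complex.sub_re, Complex.sub_im]
  have hbond : ∑ b ∈ S, ‖φ b.tgt - φ b.src‖ ^ 2 = ∑ b ∈ S, (fR b.tgt - fR b.src) ^ 2 + ∑ b ∈ S, (fI b.tgt - fI b.src) ^ 2 := by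
    rw [← sum_add_distrib]
    exact sum_congr rfl fun b _ => by rw [norm_sq_re_im, Complex.sub_re, Complex.sub_im]
  have hmean : (B.card : ℝ) * (avg B fR - c.re) ^ 2 + (B.card : ℝ) * (avg B fI - c.im) ^ 2
      = ((P.L : ℝ) ^ (k * P.d))⁻¹ * ‖∑ x ∈ B, (φ x - c)‖ ^ 2 := by
    have hc0 : (B.card : ℝ) ≠ 0 := by rw [hN]; exact hNpos.ne'
    rw [card_mul_avg_sub_sq B hc0 fR c.re, card_mul_avg_sub_sq B hc0 fI c.im, norm_sq_re_im, Complex.re_sum, Complex.im_sum, hN]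
    simp only [hfR, hfI, Complex.sub_re, Complex.sub_im]
    rw [← add_div, div_eq_inv_mul]
  have hC0 : 0 ≤ ((P.L : ℝ) ^ k - 1) * (P.L : ℝ) ^ k / 2 := by
    have h1 : (1 : ℝ) ≤ (P.L : ℝ) ^ k := one_le_pow₀ (by exact_mod_cast P.L_pos)
    have : 0 ≤ (P.L : ℝ) ^ k - 1 := by linarith
    positivity
  rw [hL, hR, hI, hbond, mul_add]
  linarith [hPR, hPI, hmean]

/-! ## §3 Coercivity of `a_kQ_k(u)^*Q_k(u) + D_u^*D_u` at a background close to `1` inside the blocks -/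

/-- Jensen / Cauchy–Schwarz on a finite set: `|Σ_{x∈s} a_x|² ≤ |s|·Σ_{x∈s}|a_x|²`. [folklore] -/
private theorem norm_sum_sq_le_card_mul {ι : Type*} (s : Finset ι) (a : ι → ℂ) :
    ‖∑ x ∈ s, a x‖ ^ 2 ≤ s.card * ∑ x ∈ s, ‖a x‖ ^ 2 :=
  calc ‖∑ x ∈ s, a x‖ ^ 2 ≤ (∑ x ∈ s, ‖a x‖) ^ 2 := pow_le_pow_left₀ (norm_nonneg _) (norm_sum_le _ _) 2
    _ ≤ s.card * ∑ x ∈ s, ‖a x‖ ^ 2 := sq_sum_le_card_mul_sum_sq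

/-- `|a + b|² ≤ 2|a|² + 2|b|²`. [folklore] -/
private theorem norm_add_sq_le_two (a b : ℂ) : ‖a + b‖ ^ 2 ≤ 2 * ‖a‖ ^ 2 + 2 * ‖b‖ ^ 2 := by
  have h1 : ‖a + b‖ ^ 2 ≤ (‖a‖ + ‖b‖) ^ 2 := pow_le_pow_left₀ (norm_nonneg _) (norm_add_le a b) 2
  nlinarith [sq_nonneg (‖a‖ - ‖b‖)]

/-- kernel: the deviation of a `k`-block sum from `L^{kd}` times the covariant average (2.6) at level `k`:
`Σ_{x∈B^k(y)} (φ(x) − (Q_k(u)φ)(y)) = Σ_{x∈B^k(y)} (1 − u(Γ^{(k)}_{x_k,x}))φ(x)` (`qCovK_apply`, `|B^k(y)| = L^{kd}`).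
[cite: BalabanImbrieJaffe1985, (2.6) p.303] -/
theorem sum_sub_qCovK_eq {k : ℕ} (hk : j + k ≤ P.m + P.K) (U : GaugeField P j U1) (φ : HiggsField P j)
    (y : Balaban1983to89.Site P (j + k)) :
    ∑ x ∈ blockK k y, (φ x - qCovK U k φ y) = ∑ x ∈ blockK k y, (1 - holCK U k x) * φ x := by
  have hN : ((blockK k y).card : ℂ) = (P.L : ℂ) ^ (k * P.d) := by rw [card_blockK k hk y, Nat.cast_pow]
  have hN0 : (P.L : ℂ) ^ (k * P.d) ≠ 0 := pow_ne_zero _ (Nat.cast_ne_zero.2 P.L_pos.ne')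
  rw [sum_sub_distrib, sum_const, nsmul_eq_mul, hN, qCovK_apply, ← mul_assoc, mul_inv_cancel₀ hN0, one_mul, ← sum_sub_distrib]
  exact sum_congr rfl fun x _ => by ring

/-- **COERCIVITY AT A BACKGROUND CLOSE TO `1` INSIDE THE `k`-BLOCKS** — the `η`-lattice Poincaré step of *"the proofs of [7]"* at a
non-flat background, with the smallness entering ONLY through sup-norms: if `|u_b − 1| ≤ T` for every bond with both ends in one `k`-block
and `|u(Γ^{(k)}_{x_k,x}) − 1| ≤ δ` for every site, then for every `φ : T^{(j)} → ℂ` (`j + k ≤ m + K`, `n = L^k`, `N = L^{kd}`)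
`(1 − 2(n−1)n·d·T² − 2δ²)·Σ_x |φ(x)|² ≤ 2(n−1)n·Σ_b |u_bφ(b₊) − φ(b₋)|² + 2N·Σ_y |(Q_k(u)φ)(y)|²`.
Proof: per block `Σ|φ|² ≤ 2Σ|φ − (Q_kφ)(y)|² + 2N|(Q_kφ)(y)|²`; `sum_norm_sub_sq_le` with centre `(Q_k(u)φ)(y)`; the mean defect is
`N^{−1}|Σ(1 − u(Γ^{(k)}))φ|² ≤ δ²Σ|φ|²` (`sum_sub_qCovK_eq`, Cauchy–Schwarz); inside a block `|φ(b₊) − φ(b₋)|² ≤ 2|u_bφ(b₊) − φ(b₋)|² +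
2T²|φ(b₊)|²`, and every site is the final point of `d` bonds.  (p. 326: *"u_k can be transformed … into a configuration of the form
exp[ie_kηA], where A is smooth and small"* — here only `|e_kηA| ≤ T` is used.) [cite: BalabanImbrieJaffe1985, (7.3.2) p.326] -/
theorem sum_norm_sq_le_cov {k : ℕ} (hk : j + k ≤ P.m + P.K) (U : GaugeField P j U1) {T δ : ℝ}
    (hInt : ∀ b : PBond P j, blkIter k b.src = blkIter k b.tgt → ‖toC (U b) - 1‖ ≤ T)
    (hTree : ∀ x : Balaban1983to89.Site P j, ‖holCK U k x - 1‖ ≤ δ) (φ : HiggsField P j) :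
    (1 - (2 * (((P.L : ℝ) ^ k - 1) * (P.L : ℝ) ^ k) * P.d * T ^ 2 + 2 * δ ^ 2))
        * ∑ x : Balaban1983to89.Site P j, ‖φ x‖ ^ 2
      ≤ 2 * (((P.L : ℝ) ^ k - 1) * (P.L : ℝ) ^ k) * ∑ b : PBond P j, ‖toC (U b) * φ b.tgt - φ b.src‖ ^ 2
        + 2 * (P.L : ℝ) ^ (k * P.d) * ∑ y : Balaban1983to89.Site P (j + k), ‖qCovK U k φ y‖ ^ 2 := by
  set C : ℝ := ((P.L : ℝ) ^ k - 1) * (P.L : ℝ) ^ k / 2 with hCdef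
  set N : ℝ := (P.L : ℝ) ^ (k * P.d) with hNdef
  have hNpos : 0 < N := pow_pos (Nat.cast_pos.2 P.L_pos) _
  have hC0 : 0 ≤ C := by
    have h1 : (1 : ℝ) ≤ (P.L : ℝ) ^ k := one_le_pow₀ (by exact_mod_cast P.L_pos)
    have : 0 ≤ (P.L : ℝ) ^ k - 1 := by linarith
    positivity
  have hδ : 0 ≤ δ := le_trans (norm_nonneg _) (hTree default)
  -- the integrands
  set D : PBond P j → ℝ := fun b => ‖toC (U b) * φ b.tgt - φ b.src‖ ^ 2 with hD
  set S : Balaban1983to89.Site P (j + k) → Finset (PBond P j) :=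
    fun y => univ.filter (fun b : PBond P j => blkIter k b.src = y ∧ blkIter k b.tgt = y) with hS
  -- (i)+(ii)+(iv): the bound on one block
  have hblock : ∀ y : Balaban1983to89.Site P (j + k),
      ∑ x ∈ blockK k y, ‖φ x‖ ^ 2
        ≤ 2 * (C * ∑ b ∈ S y, (2 * D b + 2 * (T ^ 2 * ‖φ b.tgt‖ ^ 2))) + 2 * (δ ^ 2 * ∑ x ∈ blockK k y, ‖φ x‖ ^ 2)
          + 2 * N * ‖qCovK U k φ y‖ ^ 2 := by
    intro y
    set c : ℂ := qCovK U k φ y with hc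
    -- (i)
    have h1 : ∑ x ∈ blockK k y, ‖φ x‖ ^ 2 ≤ 2 * ∑ x ∈ blockK k y, ‖φ x - c‖ ^ 2 + 2 * N * ‖c‖ ^ 2 := by
      calc ∑ x ∈ blockK k y, ‖φ x‖ ^ 2 ≤ ∑ x ∈ blockK k y, (2 * ‖φ x - c‖ ^ 2 + 2 * ‖c‖ ^ 2) :=
            sum_le_sum fun x _ => by
              have h := norm_add_sq_le_two (φ x - c) c
              rwa [sub_add_cancel] at h
        _ = 2 * ∑ x ∈ blockK k y, ‖φ x - c‖ ^ 2 + 2 * N * ‖c‖ ^ 2 := by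
            rw [sum_add_distrib, ← mul_sum, sum_const, card_blockK k hk y, nsmul_eq_mul, Nat.cast_pow, hNdef]; ring
    -- (ii)
    have h2 := sum_norm_sub_sq_le hk y φ c
    -- (iii) inside the block
    have h3 : ∑ b ∈ S y, ‖φ b.tgt - φ b.src‖ ^ 2 ≤ ∑ b ∈ S y, (2 * D b + 2 * (T ^ 2 * ‖φ b.tgt‖ ^ 2)) := by
      refine sum_le_sum fun b hb => ?_
      have hb' : blkIter k b.src = blkIter k b.tgt := by
        simp only [hS, mem_filter, mem_univ, true_and] at hb; rw [hb.1, hb.2]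
      have e : φ b.tgt - φ b.src = (toC (U b) * φ b.tgt - φ b.src) + (1 - toC (U b)) * φ b.tgt := by ring
      rw [e]
      refine (norm_add_sq_le_two _ _).trans (add_le_add le_rfl (mul_le_mul_of_nonneg_left ?_ (by norm_num)))
      rw [norm_mul, mul_pow]
      refine mul_le_mul_of_nonneg_right ?_ (sq_nonneg _)
      rw [norm_sub_rev]
      exact pow_le_pow_left₀ (norm_nonneg _) (hInt b hb') 2
    -- (iv) the mean defect
    have h4 : N⁻¹ * ‖∑ x ∈ blockK k y, (φ x - c)‖ ^ 2 ≤ δ ^ 2 * ∑ x ∈ blockK k y, ‖φ x‖ ^ 2 := by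
      rw [hc, sum_sub_qCovK_eq hk U φ y]
      have h5 := norm_sum_sq_le_card_mul (blockK k y) (fun x => (1 - holCK U k x) * φ x)
      rw [card_blockK k hk y, Nat.cast_pow] at h5
      have h6 : ∑ x ∈ blockK k y, ‖(1 - holCK U k x) * φ x‖ ^ 2 ≤ δ ^ 2 * ∑ x ∈ blockK k y, ‖φ x‖ ^ 2 := by
        rw [mul_sum]
        refine sum_le_sum fun x _ => ?_
        rw [norm_mul, mul_pow]
        refine mul_le_mul_of_nonneg_right ?_ (sq_nonneg _)
        rw [norm_sub_rev]
        exact pow_le_pow_left₀ (norm_nonneg _) (hTree x) 2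
      calc N⁻¹ * ‖∑ x ∈ blockK k y, (1 - holCK U k x) * φ x‖ ^ 2
          ≤ N⁻¹ * (N * (δ ^ 2 * ∑ x ∈ blockK k y, ‖φ x‖ ^ 2)) :=
            mul_le_mul_of_nonneg_left (h5.trans (mul_le_mul_of_nonneg_left h6 hNpos.le)) (inv_nonneg.2 hNpos.le)
        _ = δ ^ 2 * ∑ x ∈ blockK k y, ‖φ x‖ ^ 2 := by rw [← mul_assoc, inv_mul_cancel₀ hNpos.ne', one_mul]
    have h23 : ∑ x ∈ blockK k y, ‖φ x - c‖ ^ 2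
        ≤ C * ∑ b ∈ S y, (2 * D b + 2 * (T ^ 2 * ‖φ b.tgt‖ ^ 2)) + δ ^ 2 * ∑ x ∈ blockK k y, ‖φ x‖ ^ 2 :=
      h2.trans (add_le_add (mul_le_mul_of_nonneg_left h3 hC0) h4)
    linarith [h1, h23]
  -- summing over the blocks
  have hsumS : ∀ G : PBond P j → ℝ, (∀ b, 0 ≤ G b) →
      ∑ y : Balaban1983to89.Site P (j + k), ∑ b ∈ S y, G b ≤ ∑ b : PBond P j, G b := by
    intro G hG
    calc ∑ y : Balaban1983to89.Site P (j + k), ∑ b ∈ S y, G b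
        ≤ ∑ y : Balaban1983to89.Site P (j + k), ∑ b ∈ univ.filter (fun b : PBond P j => blkIter k b.src = y), G b :=
          sum_le_sum fun y _ => sum_le_sum_of_subset_of_nonneg
            (fun b hb => by simp only [hS, mem_filter, mem_univ, true_and] at hb ⊢; exact hb.1) fun _ _ _ => hG _
      _ = ∑ b : PBond P j, G b := sum_fiberwise univ (fun b : PBond P j => blkIter k b.src) G
  have hI1 : ∑ y : Balaban1983to89.Site P (j + k), ∑ b ∈ S y, (2 * D b + 2 * (T ^ 2 * ‖φ b.tgt‖ ^ 2))
      ≤ ∑ b : PBond P j, (2 * D b + 2 * (T ^ 2 * ‖φ b.tgt‖ ^ 2)) :=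
    hsumS _ fun b => by positivity
  have htgt : ∑ b : PBond P j, ‖φ b.tgt‖ ^ 2 = P.d * ∑ x : Balaban1983to89.Site P j, ‖φ x‖ ^ 2 := by
    rw [sum_bond_eq]
    exact sum_sum_shift_dir (fun x => ‖φ x‖ ^ 2)
  have htot : ∑ x : Balaban1983to89.Site P j, ‖φ x‖ ^ 2
      = ∑ y : Balaban1983to89.Site P (j + k), ∑ x ∈ blockK k y, ‖φ x‖ ^ 2 := (sum_blockK_sum (k := k) _).symm
  have hmain : ∑ x : Balaban1983to89.Site P j, ‖φ x‖ ^ 2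
      ≤ 2 * (C * ∑ b : PBond P j, (2 * D b + 2 * (T ^ 2 * ‖φ b.tgt‖ ^ 2)))
        + 2 * (δ ^ 2 * ∑ x : Balaban1983to89.Site P j, ‖φ x‖ ^ 2)
        + 2 * N * ∑ y : Balaban1983to89.Site P (j + k), ‖qCovK U k φ y‖ ^ 2 := by
    calc ∑ x : Balaban1983to89.Site P j, ‖φ x‖ ^ 2
        = ∑ y : Balaban1983to89.Site P (j + k), ∑ x ∈ blockK k y, ‖φ x‖ ^ 2 := htot
      _ ≤ ∑ y : Balaban1983to89.Site P (j + k),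
            (2 * (C * ∑ b ∈ S y, (2 * D b + 2 * (T ^ 2 * ‖φ b.tgt‖ ^ 2))) + 2 * (δ ^ 2 * ∑ x ∈ blockK k y, ‖φ x‖ ^ 2)
              + 2 * N * ‖qCovK U k φ y‖ ^ 2) := sum_le_sum fun y _ => hblock y
      _ = 2 * (C * ∑ y : Balaban1983to89.Site P (j + k), ∑ b ∈ S y, (2 * D b + 2 * (T ^ 2 * ‖φ b.tgt‖ ^ 2)))
          + 2 * (δ ^ 2 * ∑ y : Balaban1983to89.Site P (j + k), ∑ x ∈ blockK k y, ‖φ x‖ ^ 2)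
          + 2 * N * ∑ y : Balaban1983to89.Site P (j + k), ‖qCovK U k φ y‖ ^ 2 := by
          rw [sum_add_distrib, sum_add_distrib, ← mul_sum, ← mul_sum, ← mul_sum, ← mul_sum, ← mul_sum]
      _ ≤ _ := by
          rw [← htot]
          have := mul_le_mul_of_nonneg_left hI1 hC0
          linarith
  rw [sum_add_distrib, ← mul_sum, ← mul_sum, ← mul_sum, htgt] at hmain
  have hCe : 2 * (((P.L : ℝ) ^ k - 1) * (P.L : ℝ) ^ k) = 4 * C := by rw [hCdef]; ring
  rw [hCe]
  nlinarith [hmain, hC0, sq_nonneg T, sq_nonneg δ, sum_nonneg (fun x (_ : x ∈ (univ : Finset (Balaban1983to89.Site P j))) => sq_nonneg ‖φ x‖)]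

end

end Literature.MathematicalPhysics.QuantumFieldTheory.BalabanImbrieJaffe1984to88.BIJ85BlockKPoincare
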